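import Literature.MathematicalPhysics.QuantumManyBody.BoseGasThermodynamicLimitRuelle
import Literature.MathematicalPhysics.QuantumManyBody.PeriodicBoseGasJastrow
import Summits.AtomisticToContinuum.BoseEinsteinCondensation.Theorems.BECInfDivCoherenceGridInfDivCoherenceFreeRegionMaximiser
import Mathlib.Topology.Connected.PathConnected
import Mathlib.Analysis.Convex.PathConnected
import HarnessLib

/-!
# Crux `GridInfDivCoherence` (stmt-AtomisticToContinuum-9114), line `registered`: sub-goal (D1) of the dilute
# hard-sphere connectivity statement — lattice retraction of a `4(L/M)`-separated configuration

The free region of `N` hard spheres with exclusion distance `b` on the torus `ℝ³/Lℤ³`, written on `(ℝ³)^N` with all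
lattice images, is `F = {X | ∀ i ≠ j, ∀ n ∈ ℤ³, b < ‖X i - X j - L n‖}`. Write `s = L/M` and assume `2bM < L`, i.e.
`2b < s`. We show (`freeRegion_joined_latticeConfig`, the registered signature): every configuration `X` all of whose
image pair distances are `≥ 4s` is joined inside `F` to a configuration `T` on the lattice `sℤ³` all of whose image
pair distances are `≥ s`.

Proof (namespace `FreeRegionRetraction`; no auxiliary definitions): let `T i = s·n(X i)` be the nearest point of
`sℤ³` (coordinatewise rounding, the tree's `nearestLat`/`reduce` of `PeriodicBoseGasJastrow.lean`), so every
coordinate of `X i - T i` is `≤ s/2` in absolute value and `‖X i - T i‖ ≤ s`. If `W` is ANY configuration with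
`‖W i - X i‖ ≤ s` for all `i` (the closed sup-norm ball of radius `s` about `X` in `(ℝ³)^N`), then by the triangle
inequality every image pair distance of `W` is `≥ 4s - 2s = 2s > b`; hence this ball lies in `F`, the image pair
distances of `T` are `≥ 2s ≥ s`, and, the ball being convex and containing `X` and `T`, the straight segment from `X`
to `T` joins them inside `F` (Mathlib's `JoinedIn.of_segment_subset`, `convex_closedBall`). (Moving the particles one
at a time, as in the informal argument, is not needed: the simultaneous straight-line motion already stays in `F`.)
For `N ≤ 1` everything is vacuous and the same formulae apply.

References: folklore (configuration spaces of hard spheres, e.g. Baryshnikov–Bubenik–Kahle, IMRN 2014, §2); Mathlib's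
`JoinedIn.of_segment_subset`, `convex_closedBall`, `norm_le_pi_norm`, `pi_norm_le_iff_of_nonneg`; the tree's
`nearestLat`, `reduce`, `abs_reduce_apply_le` (`PeriodicBoseGasJastrow.lean`) and
`FreeRegionMaximiser.norm_le_two_mul_of_abs_le` (sub-goal (A), `…FreeRegionMaximiser.lean`).
-/

noncomputable section

namespace Summit.AtomisticToContinuum.BoseEinsteinCondensation.Theorems

open Filter Literature.MathematicalPhysics.QuantumManyBody Literature.MathematicalPhysics.QuantumManyBody.BoseGas

namespace FreeRegionRetraction

variable {N : ℕ} {L : ℝ}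

/-- If every particle of `W` is within distance `s` of the corresponding particle of `X`, then every image pair
distance of `W` is at least the corresponding image pair distance of `X` minus `2s` (triangle inequality).
[folklore] -/
theorem imageDist_sub_le_of_near {X W : Config N} {s : ℝ} (hW : ∀ i, ‖W i - X i‖ ≤ s) (i j : Fin N)
    (n : Fin 3 → ℤ) : ‖X i - X j - latticeVec L n‖ - 2 * s ≤ ‖W i - W j - latticeVec L n‖ := by
  have key : X i - X j - latticeVec L n = (W i - W j - latticeVec L n) - ((W i - X i) - (W j - X j)) := by
    abel
  have h1 := norm_sub_le (W i - W j - latticeVec L n) ((W i - X i) - (W j - X j))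
  have h2 := norm_sub_le (W i - X i) (W j - X j)
  rw [← key] at h1
  linarith [hW i, hW j]

/-- The closed sup-norm ball of radius `s` about a configuration all of whose image pair distances are `≥ 4s` lies
in the free region of any exclusion distance `b < 2s`. [folklore] -/
theorem closedBall_subset_freeRegion {X : Config N} {s b : ℝ} (hb : b < 2 * s)
    (hX : ∀ i j : Fin N, i ≠ j → ∀ n : Fin 3 → ℤ, 4 * s ≤ ‖X i - X j - latticeVec L n‖) :
    Metric.closedBall X s ⊆
      {X : Config N | ∀ i j : Fin N, i ≠ j → ∀ n : Fin 3 → ℤ, b < ‖X i - X j - latticeVec L n‖} := by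
  intro W hW i j hij n
  rw [Metric.mem_closedBall, dist_eq_norm] at hW
  have hWi : ∀ i, ‖W i - X i‖ ≤ s := fun i => (norm_le_pi_norm (W - X) i).trans hW
  have h := imageDist_sub_le_of_near (L := L) hWi i j n
  linarith [hX i j hij n]

/-- The nearest point `s·n(y)` of the lattice `sℤ³` (`s > 0`, coordinatewise rounding) is within distance `s` of
`y`: each coordinate of the difference is `≤ s/2` in absolute value. [folklore] -/
theorem norm_sub_latticeVec_nearestLat_le {s : ℝ} (hs : 0 < s) (y : Space) :
    ‖y - latticeVec s (nearestLat s y)‖ ≤ s := by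
  have h : ‖reduce s y‖ ≤ 2 * (s / 2) :=
    FreeRegionMaximiser.norm_le_two_mul_of_abs_le (by positivity) fun k => abs_reduce_apply_le hs y k
  rw [reduce] at h
  linarith

end FreeRegionRetraction

/-- **Sub-goal (D1) of the dilute hard-sphere connectivity statement G** (crux `GridInfDivCoherence`, line
`registered`), the lattice retraction: on the torus `ℝ³/Lℤ³` with `2bM < L`, every configuration `X` all of whose
image pair distances are `≥ 4(L/M)` is joined, inside the hard-sphere free region
`F = {X | ∀ i ≠ j, ∀ n ∈ ℤ³, b < ‖X i - X j - L n‖}`, to a configuration `T` on the lattice `(L/M)ℤ³` all of whose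
image pair distances are `≥ L/M` — namely the particlewise nearest lattice points, reached along the straight
segment, which stays in the sup-norm ball of radius `L/M` about `X`, a convex subset of `F`. [folklore] -/
theorem freeRegion_joined_latticeConfig :
    ∀ (N M : ℕ) (L b : ℝ), 0 < M → 0 < b → 2 * b * M < L →
      ∀ X : Config N, (∀ i j : Fin N, i ≠ j → ∀ n : Fin 3 → ℤ, 4 * (L / M) ≤ ‖X i - X j - latticeVec L n‖) →
        ∃ T : Config N, (∀ i, ∃ z : Fin 3 → ℤ, T i = latticeVec (L / M) z) ∧
          (∀ i j : Fin N, i ≠ j → ∀ n : Fin 3 → ℤ, L / M ≤ ‖T i - T j - latticeVec L n‖) ∧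
          JoinedIn {X : Config N | ∀ i j : Fin N, i ≠ j → ∀ n : Fin 3 → ℤ, b < ‖X i - X j - latticeVec L n‖} X T := by
  intro N M L b hM hb hbML X hX
  have hMpos : (0 : ℝ) < M := by exact_mod_cast hM
  set s : ℝ := L / M with hs_def
  have hbs : 2 * b < s := by
    rw [hs_def, lt_div_iff₀ hMpos]
    exact hbML
  have hs : 0 < s := by linarith
  obtain ⟨T, hT⟩ : ∃ T : Config N, ∀ i, T i = latticeVec s (nearestLat s (X i)) := ⟨_, fun _ => rfl⟩
  have hTX : ∀ i, ‖T i - X i‖ ≤ s := fun i => by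
    rw [hT, norm_sub_rev]
    exact FreeRegionRetraction.norm_sub_latticeVec_nearestLat_le hs (X i)
  refine ⟨T, fun i => ⟨_, hT i⟩, fun i j hij n => ?_, ?_⟩
  · have h := FreeRegionRetraction.imageDist_sub_le_of_near (L := L) hTX i j n
    linarith [hX i j hij n]
  · have hball := FreeRegionRetraction.closedBall_subset_freeRegion (L := L) (by linarith : b < 2 * s) hX
    have hTmem : T ∈ Metric.closedBall X s := by
      rw [Metric.mem_closedBall, dist_eq_norm, pi_norm_le_iff_of_nonneg hs.le]
      exact hTX
    exact (JoinedIn.of_segment_subset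
      ((convex_closedBall X s).segment_subset (Metric.mem_closedBall_self hs.le) hTmem)).mono hball

end Summit.AtomisticToContinuum.BoseEinsteinCondensation.Theorems

end
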